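import Summits.NavierStokesRegularity.FunctionalMining.PlanarShadowWitness
import Summits.NavierStokesRegularity.FunctionalMining.PlanarShadowDoor
import Summits.NavierStokesRegularity.FunctionalMining.GradPressureMomentRate
import Summits.NavierStokesRegularity.FunctionalMining.PidevMomentRate
import HarnessLib

/-!
# FunctionalMining — the planar witness: exact inertial rates of `∫|S|⁴`, `∫π²`, `∫|∇π|²`, `∫|Π^dev|²`
# (planar shadow, part 3)

Search for candidate a priori estimates; no regularity claim. Cell `pub-nsfunc`, prove seat
(gen 18). Static evaluations of the tree's inertial-rate functionals at ONE explicit field; nothing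
about Navier–Stokes dynamics is asserted.

For the planar witness `w` of `PlanarShadowWitness` (`λ₂(S) ≡ 0`, `σ ≡ 0`) the Euler tendencies of
four K0 functionals are computed EXACTLY from the Fourier tables (`TrigPolyExact`, values by
`decide +kernel`; cross-checked by two independent programs, cell DERIVATIVES §35):

* `pressureSqInertialSource w = (2π)³ · evalR Bt` (the `ν`-free part of `∂ₜ(−tr(∇u)²)` at `u = w`),
  `Δ⁻¹` of it `= 2π · evalR (linv Bt)`;
* **`strainMomentInertialRate 4 w = (2/5)(2π)⁵ > 0`** (row core `ES.absS.q=4`);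
* **`pressureSqInertialRate w = (49/50)·2π > 0`** (`EP.p.q=2`);
* **`gradPressureSqInertialRate w = (9/5)(2π)³ > 0`** (`EP.gradp.q=2`);
* **`pidevSqInertialRate w = (44/15)(2π)⁵ > 0`** (`EP.Pidev.q=2`).

Part 4 (`PlanarShadowKill`) feeds these signs through the C3a/C3b doors.
-/

noncomputable section

open MeasureTheory Complex UnitAddTorus

namespace Summit.NavierStokesRegularity.FunctionalMining

open Literature.Analysis Literature.Analysis.FunctionSpaces Literature.Analysis.FunctionSpaces.Torus
  Literature.Analysis.FluidPDE
open TrigPolyExact TrigPolyExact.TP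

namespace PlanarShadow

/-- Real identities from complex ones: `(a : ℂ) = c · z` with `c` real gives `a = c · Re z`. [folklore] -/
theorem real_eq_of_complex {a c : ℝ} {z : ℂ} (h : (a : ℂ) = (c : ℂ) * z) : a = c * z.re := by
  have := congrArg Complex.re h
  simpa [Complex.mul_re] using this

/-! ## 1. The inertial pressure source `B` and `Δ⁻¹B` in table form -/

/-- Table of `∑ₖ wₖ (∂ₖ∂ᵢw)ⱼ / (2π)²`. [ours; bookkeeping] -/
def CVT (i j : Fin 3) : TP := collect (sum3 fun k => mulC (W k) (TP.D k (TP.D i (W j))))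

/-- Table `Bt` of `B/(2π)³`, `B = −2∑ᵢⱼ (−∂ᵢ∂ⱼπ − ∑ₖ∂ᵢwₖ∂ₖwⱼ − ∑ₖwₖ∂ₖ∂ᵢwⱼ)(∂ⱼw)ᵢ`
(`pressureSqInertialSource`). [ours; bookkeeping] -/
def Bt : TP :=
  collect (smul (-2) (sum3 fun i => sum3 fun j =>
    mulC (neg (TP.D i (TP.D j P)) ++ neg (NLT i j) ++ neg (CVT i j)) (TP.D j (W i))))

/-- `Bt` is real. [ours; bookkeeping] -/
theorem isReal_Bt : IsReal Bt := by
  refine (IsReal.smul (IsReal.sum3 fun i => IsReal.sum3 fun j => IsReal.mulC ?_ ((isReal_W i).D j)) _).collect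
  exact (((isReal_P.D j).D i).neg.append
    (IsReal.sum3 fun k => ((isReal_W k).D i).mulC ((isReal_W j).D k)).collect.neg).append
    (IsReal.sum3 fun k => (isReal_W k).mulC (((isReal_W j).D i).D k)).collect.neg

/-- **`B = (2π)³ · evalR Bt`.** [ours] -/
theorem pressureSqInertialSource_w (x : UnitAddTorus (Fin 3)) :
    pressureSqInertialSource w x = (2 * Real.pi) ^ 3 * evalR Bt x := by
  refine real_eq_of_complex ?_
  simp only [pressureSqInertialSource, Fin.sum_univ_three, hessian_pressureOf_w, partialDeriv_w,
    partialDeriv_partialDeriv_w, w_apply]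
  push_cast
  simp only [← eval_DW, ← eval_DDW, ← eval_W, ← eval_DDP, Bt, NLT, CVT, eval_collect, eval_smul,
    eval_sum3, eval_append, eval_neg, eval_mulC]
  push_cast
  ring

/-- `Bt` has no zero mode. [ours; by `decide`] -/
theorem noZeroMode_Bt : NoZeroMode Bt := by decide +kernel

/-- **`Δ⁻¹B = 2π · evalR (linv Bt)`.** [ours] -/
theorem invLaplacian_pressureSqInertialSource_w :
    Torus.invLaplacian (pressureSqInertialSource w) = fun x => 2 * Real.pi * evalR (linv Bt) x := by
  have h1 : pressureSqInertialSource w = ((2 * Real.pi) ^ 3) • evalR Bt := by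
    funext x; simp [pressureSqInertialSource_w]
  rw [h1, invLaplacian_const_smul _ _ (isSmooth_evalR _), invLaplacian_evalR noZeroMode_Bt]
  funext x
  have hpi : (2 * Real.pi : ℝ) ≠ 0 := by positivity
  simp only [Pi.smul_apply, smul_eq_mul]
  field_simp

/-- Atoms are real: `eval (linv Bt) = evalR (linv Bt)`, `eval Bt = evalR Bt`. [ours; bookkeeping] -/
theorem eval_linvBt (x : UnitAddTorus (Fin 3)) :
    eval (linv Bt) x = ((evalR (linv Bt) x : ℝ) : ℂ) := (isReal_Bt.linv noZeroMode_Bt).eval_eq x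

/-- See `eval_linvBt`. [ours; bookkeeping] -/
theorem eval_Bt (x : UnitAddTorus (Fin 3)) : eval Bt x = ((evalR Bt x : ℝ) : ℂ) := isReal_Bt.eval_eq x

/-- Atoms are real: `eval Q = evalR Q`. [ours; bookkeeping] -/
theorem eval_Q (x : UnitAddTorus (Fin 3)) : eval Q x = ((evalR Q x : ℝ) : ℂ) := isReal_Q.eval_eq x

/-! ## 2. `EP.p.q=2`: the inertial rate of `∫π²` -/

/-- The zero mode of `P · linv Bt`. [ours; by `decide`] -/
theorem coeff0_P_linvBt : coeff0 (mulC P (linv Bt)) = ⟨49 / 100, 0⟩ := by decide +kernel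

/-- **`pressureSqInertialRate w = (49/50)·(2π)`.** [ours] -/
theorem pressureSqInertialRate_w : pressureSqInertialRate w = 49 / 50 * (2 * Real.pi) := by
  unfold pressureSqInertialRate
  rw [invLaplacian_pressureSqInertialSource_w, pressureOf_w]
  have hpt : ∀ x, 2 * evalR P x * (2 * Real.pi * evalR (linv Bt) x) =
      (4 * Real.pi) * evalR (mulC P (linv Bt)) x := by
    intro x
    rw [evalR_mulC isReal_P (isReal_Bt.linv noZeroMode_Bt)]
    ring
  simp_rw [hpt]
  rw [integral_const_mul, integral_evalR, coeff0_P_linvBt]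
  ring

/-- **`pressureSqInertialRate w > 0`.** [ours] -/
theorem pressureSqInertialRate_w_pos : 0 < pressureSqInertialRate w := by
  rw [pressureSqInertialRate_w]; positivity

/-! ## 3. `EP.gradp.q=2`: the inertial rate of `∫|∇π|²` -/

/-- The zero mode of `P · Bt`. [ours; by `decide`] -/
theorem coeff0_P_Bt : coeff0 (mulC P Bt) = ⟨-9 / 10, 0⟩ := by decide +kernel

/-- **`gradPressureSqInertialRate w = (9/5)(2π)³`.** [ours] -/
theorem gradPressureSqInertialRate_w : gradPressureSqInertialRate w = 9 / 5 * (2 * Real.pi) ^ 3 := by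
  unfold gradPressureSqInertialRate
  rw [pressureOf_w]
  have hpt : ∀ x, evalR P x * pressureSqInertialSource w x =
      (2 * Real.pi) ^ 3 * evalR (mulC P Bt) x := by
    intro x
    rw [pressureSqInertialSource_w, evalR_mulC isReal_P isReal_Bt]
    ring
  simp_rw [hpt]
  rw [integral_const_mul, integral_evalR, coeff0_P_Bt]
  ring

/-- **`gradPressureSqInertialRate w > 0`.** [ours] -/
theorem gradPressureSqInertialRate_w_pos : 0 < gradPressureSqInertialRate w := by
  rw [gradPressureSqInertialRate_w]; positivity

/-! ## 4. `EP.Pidev.q=2`: the inertial rate of `∫|Π^dev|²` -/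

/-- The zero mode of `(−Q) · Bt`. [ours; by `decide`] -/
theorem coeff0_negQ_Bt : coeff0 (mulC (neg Q) Bt) = ⟨11 / 5, 0⟩ := by decide +kernel

/-- The zero mode of `−Q`. [ours; by `decide`] -/
theorem coeff0_negQ : coeff0 (neg Q) = GQ.zero := by decide +kernel

/-- The zero mode of `Bt`. [ours; by `decide`] -/
theorem coeff0_Bt : coeff0 Bt = GQ.zero := by decide +kernel

/-- **`pidevSqInertialRate w = (44/15)(2π)⁵`.** [ours] -/
theorem pidevSqInertialRate_w : pidevSqInertialRate w = 44 / 15 * (2 * Real.pi) ^ 5 := by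
  unfold pidevSqInertialRate
  have h1 : ∀ x, -gradSqTrace w x * pressureSqInertialSource w x =
      (2 * Real.pi) ^ 5 * evalR (mulC (neg Q) Bt) x := by
    intro x
    rw [gradSqTrace_w, pressureSqInertialSource_w, evalR_mulC isReal_Q.neg isReal_Bt, evalR_neg]
    ring
  have h2 : ∀ x, -gradSqTrace w x = (2 * Real.pi) ^ 2 * evalR (neg Q) x := by
    intro x; rw [gradSqTrace_w, evalR_neg]; ring
  have h3 : ∀ x, pressureSqInertialSource w x = (2 * Real.pi) ^ 3 * evalR Bt x :=
    pressureSqInertialSource_w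
  simp_rw [h1, h2, h3]
  rw [integral_const_mul, integral_const_mul, integral_const_mul, integral_evalR, integral_evalR,
    integral_evalR, coeff0_negQ_Bt, coeff0_negQ, coeff0_Bt, Fintype.card_fin]
  simp [GQ.zero]
  ring

/-- **`pidevSqInertialRate w > 0`.** [ours] -/
theorem pidevSqInertialRate_w_pos : 0 < pidevSqInertialRate w := by
  rw [pidevSqInertialRate_w]; positivity

/-! ## 5. `ES.absS.q=4`: the inertial rate of `∫|S|⁴` -/

/-- Table of `|S|²/(2π)²`. [ours; bookkeeping] -/
def S2T : TP := collect (sum3 fun i => sum3 fun j => mulC (ST i j) (ST i j))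

/-- **`|S(w)|² = (2π)² · evalR S2T`.** [ours] -/
theorem strainSqAt_w (x : UnitAddTorus (Fin 3)) : torusStrainSqAt w x = (2 * Real.pi) ^ 2 * evalR S2T x := by
  refine real_eq_of_complex ?_
  simp only [torusStrainSqAt, Fin.sum_univ_three, strain_entry]
  push_cast
  simp only [← eval_ST, S2T, eval_collect, eval_sum3, eval_mulC]
  ring

/-- Atoms are real: `eval S2T = evalR S2T`. [ours; bookkeeping] -/
theorem eval_S2T (x : UnitAddTorus (Fin 3)) : eval S2T x = ((evalR S2T x : ℝ) : ℂ) :=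
  (IsReal.sum3 fun i => IsReal.sum3 fun j =>
    (((((isReal_W i).D j).append ((isReal_W j).D i)).smul _).mulC
      ((((isReal_W i).D j).append ((isReal_W j).D i)).smul _))).collect.eval_eq x

/-- Table of the pressure-Hessian production integrand `|S|² ∑ᵢⱼ Sᵢⱼ ∂ᵢ∂ⱼπ / (2π)⁵`. [ours; bookkeeping] -/
def I1 : TP := mulC S2T (sum3 fun i => sum3 fun j => mulC (ST i j) (TP.D i (TP.D j P)))

/-- Table of the self-interaction integrand `|S|² ∑ᵢⱼ Sᵢⱼ ∑ₖ∂ᵢwₖ∂ₖwⱼ / (2π)⁵`. [ours; bookkeeping] -/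
def I2 : TP := mulC S2T (sum3 fun i => sum3 fun j => mulC (ST i j) (NLT i j))

/-- The zero mode of `I1`. [ours; by `decide`] -/
theorem coeff0_I1 : coeff0 I1 = ⟨-1 / 10, 0⟩ := by decide +kernel

/-- The zero mode of `I2` (the self-interaction part vanishes on planar fields). [ours; by `decide`] -/
theorem coeff0_I2 : coeff0 I2 = GQ.zero := by decide +kernel

/-- **`strainMomentInertialRate 4 w = (2/5)(2π)⁵`.** [ours] -/
theorem strainMomentInertialRate_four_w :
    strainMomentInertialRate 4 (w) = 2 / 5 * (2 * Real.pi) ^ 5 := by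
  unfold strainMomentInertialRate
  have hq : ((4 : ℝ) / 2 - 1) = 1 := by norm_num
  simp only [hq, Real.rpow_one]
  have h1 : ∀ x, torusStrainSqAt w x * ∑ i, ∑ j,
      (Torus.partialDeriv j w x i + Torus.partialDeriv i w x j) / 2 *
        Torus.partialDeriv i (Torus.partialDeriv j (pressureOf w)) x =
      (2 * Real.pi) ^ 5 * evalR I1 x := by
    intro x
    refine real_eq_of_complex ?_
    simp only [Fin.sum_univ_three, strain_entry, strainSqAt_w, hessian_pressureOf_w]
    push_cast
    simp only [← eval_ST, ← eval_S2T, ← eval_DDP, I1, eval_sum3, eval_mulC]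
    ring
  have h2 : ∀ x, torusStrainSqAt w x * ∑ i, ∑ j,
      (Torus.partialDeriv j w x i + Torus.partialDeriv i w x j) / 2 *
        ∑ k, Torus.partialDeriv i w x k * Torus.partialDeriv k w x j =
      (2 * Real.pi) ^ 5 * evalR I2 x := by
    intro x
    refine real_eq_of_complex ?_
    simp only [Fin.sum_univ_three, strain_entry, strainSqAt_w]
    simp only [partialDeriv_w]
    push_cast
    simp only [← eval_ST, ← eval_S2T, ← eval_DW, I2, NLT, eval_collect, eval_sum3, eval_mulC]
    ring
  simp_rw [h1, h2]
  rw [integral_const_mul, integral_const_mul, integral_evalR, integral_evalR, coeff0_I1, coeff0_I2]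
  simp [GQ.zero]
  ring

/-- **`strainMomentInertialRate 4 w > 0`.** [ours] -/
theorem strainMomentInertialRate_four_w_pos : 0 < strainMomentInertialRate 4 w := by
  rw [strainMomentInertialRate_four_w]; positivity

end PlanarShadow

end Summit.NavierStokesRegularity.FunctionalMining

end
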